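import Literature.AlgebraicGeometry.Frobenioids.ArchimedeanFrobenioids
import Literature.AlgebraicGeometry.Frobenioids.ArchimedeanArcs
import HarnessLib

/-!
# Frobenioids II, §3: arcs around `1`, real parts and Galois twists on `O_ℂ^× = S¹`
# (abc-iut cell, layer L1; elementary toolkit for Prop. 3.4 (iii)/(viii) counterexamples and (ii)(b))

Mochizuki, *The geometry of Frobenioids II: poly-Frobenioids*, Kyushu J. Math. **62** (2008)
401–460, §3, Def. 3.1 (i)–(iv) pp. 23–24 and Lemma 3.2 p. 25 (arcs of `S¹`).
[cite: MochizukiFrdII2008, Def 3.1 (iii) p.24]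

PROOF-ONLY file (nothing defined; seat abc-iut-L1-d3), elementary facts used by the Prop. 3.4 files
`ArchimedeanHalfCircleLifts*`, `ArchimedeanFSMCounterexample*`, `ArchimedeanConjugateLifts`:
* the arc `arcDir 1 (π/2)` (t6's `ArchimedeanArcs`) is the right half-circle `{Re > 0}`
  (`mem_arcDir_one_iff`); unit parts and Galois twists preserve the sign of the real part
  (`re_unitPart_pos_iff`, `re_galAct`); hence every base change of a region with that angular part
  lies in `{Re > 0}` (`C0.re_pos_of_mem_pullRegion`);
* a `D₀`-arrow is determined by source, target and twist (`D0.hom_eq_of_twists_eq`); arrows into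
  `Spec ℝ` coincide (`D0.hom_to_real_eq`);
* arcs around `1` are additive under products while the total half-width stays `≤ π`
  (`mul_mem_arcDir_one`, `arcDir_one_pow_subset`, `smul_arcDir_one_subset`, `arcDir_subset_arcDir`);
* a nonempty open subset of `S¹` contains `z` with `Im(v z^d) ≠ 0` (`exists_mem_im_ne_zero`,
  `exists_mem_im_pow_ne_zero`): open sets of `S¹` are not contained in `{±1}`.
No side is taken on [IUTchIII] Cor. 3.12.
-/

namespace Literature.AlgebraicGeometry.Frobenioids

open CategoryTheory Set
open scoped Pointwise

noncomputable section

namespace ArchFrd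

/-! ### The right half-circle, real parts, twists -/

/-- The arc of half-width `π/2` around `1` is the open right half-circle `{Re > 0}`.
[cite: MochizukiFrdII2008, Def 3.1 (iii) p.24] -/
theorem mem_arcDir_one_iff (z : ↥(normOneSubgroup ℂ)) :
    z ∈ arcDir 1 (Real.pi / 2) ↔ 0 < (((z : ℂˣ) : ℂ)).re := by
  change relArg 1 z ∈ Set.Ioo (-(Real.pi / 2)) (Real.pi / 2) ↔ _
  unfold relArg
  rw [inv_one, mul_one, Set.mem_Ioo, ← abs_lt, Complex.abs_arg_lt_pi_div_two_iff]
  exact or_iff_left (z : ℂˣ).ne_zero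

/-- The unit part `u/|u|` has positive real part iff `u` has. [cite: MochizukiFrdII2008, Def 3.1 (ii) p.23] -/
theorem re_unitPart_pos_iff (x : ℂˣ) :
    0 < (((unitPart ℂ x : ℂˣ) : ℂ)).re ↔ 0 < (x : ℂ).re := by
  have hx : 0 < ‖(x : ℂ)‖ := norm_pos_iff.mpr x.ne_zero
  have hval : (((unitPart ℂ x : ℂˣ) : ℂ)) = (x : ℂ) * ((‖(x : ℂ)‖ : ℂ))⁻¹ := by
    show ((x * (ofPosReal ℂ (absHom ℂ x))⁻¹ : ℂˣ) : ℂ) = _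
    rw [Units.val_mul, Units.val_inv_eq_inv_val, coe_ofPosReal, coe_absHom]
    rfl
  rw [hval, ← Complex.ofReal_inv, mul_comm, Complex.re_ofReal_mul]
  exact ⟨fun h => pos_of_mul_pos_right h (inv_pos.mpr hx).le, fun h => mul_pos (inv_pos.mpr hx) h⟩

/-- Galois twists preserve real parts. [cite: MochizukiFrdII2008, Def 3.1 (i) p.23] -/
theorem re_galAct (σ : Bool) (u : ℂˣ) : ((D0.galAct σ u : ℂˣ) : ℂ).re = (u : ℂ).re := by
  cases σ
  · rw [D0.galAct_false]
  · rw [D0.galAct_true, Units.coe_star, ← starRingEnd_apply, Complex.conj_re]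

/-- A `D₀`-arrow is determined by its source, target and twist. [cite: MochizukiFrdII2008, Def 3.1 (i) p.23] -/
theorem D0.hom_eq_of_twists_eq {L K : D0} (f g : L ⟶ K) (h : D0.Hom.twists f = D0.Hom.twists g) :
    f = g := by
  cases f with
  | idReal => exact Subsingleton.elim _ _
  | toReal => exact Subsingleton.elim _ _
  | gal σ =>
    rcases D0.hom_complex_complex_eq g with rfl | rfl
    · rw [D0.twists_gal, D0.twists_id] at h
      subst h
      rfl
    · rw [D0.twists_gal, D0.twists_conj] at h
      subst h
      rfl

/-- In `S¹ = O_ℂ^×`, a nonempty open set is not contained in `{±1}`: it contains `z` with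
`Im(v z) ≠ 0`, for any fixed rotation `v`. [cite: MochizukiFrdII2008, Lem 3.2 p.25] -/
theorem exists_mem_im_ne_zero {U : Set ↥(normOneSubgroup ℂ)} (hU : IsOpen U) (hne : U.Nonempty)
    (v : ↥(normOneSubgroup ℂ)) :
    ∃ z ∈ U, (((v * z : ↥(normOneSubgroup ℂ)) : ℂˣ) : ℂ).im ≠ 0 := by
  obtain ⟨z₀, hz₀⟩ := hne
  obtain ⟨ε, hε, hεπ, harc⟩ := exists_arcDir_subset hU hz₀
  have hmem : ∀ t ∈ Set.Ioo (-ε) ε, z₀ * expUnit t ∈ U := fun t ht => by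
    apply harc
    rw [arcDir_eq_image z₀ hεπ]
    exact ⟨t, ht, rfl⟩
  -- the imaginary part along the arc is `sin (θ + t)`
  set w : ℂ := (((v * z₀ : ↥(normOneSubgroup ℂ)) : ℂˣ) : ℂ) with hw
  have hw1 : ‖w‖ = 1 := (mem_normOneSubgroup_iff ℂ _).1 (v * z₀).2
  have hwexp : w = Complex.exp (Complex.arg w * Complex.I) := by
    have := Complex.norm_mul_exp_arg_mul_I w
    rw [hw1, Complex.ofReal_one, one_mul] at this
    exact this.symm
  have him : ∀ t : ℝ, (((v * (z₀ * expUnit t) : ↥(normOneSubgroup ℂ)) : ℂˣ) : ℂ).im =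
      Real.sin (Complex.arg w + t) := by
    intro t
    have : (((v * (z₀ * expUnit t) : ↥(normOneSubgroup ℂ)) : ℂˣ) : ℂ) =
        Complex.exp (Complex.arg w * Complex.I) * Complex.exp (t * Complex.I) := by
      rw [← hwexp, hw, ← mul_assoc, Subgroup.coe_mul, Units.val_mul, coe_expUnit]
    rw [this, ← Complex.exp_add, ← Complex.exp_ofReal_mul_I_im, Complex.ofReal_add, add_mul]
  by_cases hp : (((v * (z₀ * expUnit (ε / 2)) : ↥(normOneSubgroup ℂ)) : ℂˣ) : ℂ).im ≠ 0
  · exact ⟨_, hmem (ε / 2) ⟨by linarith, by linarith⟩, hp⟩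
  by_cases hm' : (((v * (z₀ * expUnit (-(ε / 2))) : ↥(normOneSubgroup ℂ)) : ℂˣ) : ℂ).im ≠ 0
  · exact ⟨_, hmem (-(ε / 2)) ⟨by linarith, by linarith⟩, hm'⟩
  exfalso
  rw [not_ne_iff, him, Real.sin_eq_zero_iff] at hp hm'
  obtain ⟨n, hn⟩ := hp
  obtain ⟨m, hm⟩ := hm'
  have hk : ((n - m : ℤ) : ℝ) * Real.pi = ε := by
    rw [Int.cast_sub, sub_mul, hn, hm]
    ring
  have h1 : (0 : ℝ) < (n - m : ℤ) := by
    have : (0 : ℝ) < ((n - m : ℤ) : ℝ) * Real.pi := by rw [hk]; exact hε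
    exact pos_of_mul_pos_left this Real.pi_pos.le
  have h2 : ((n - m : ℤ) : ℝ) < 1 := by
    have : ((n - m : ℤ) : ℝ) * Real.pi < 1 * Real.pi := by rw [hk, one_mul]; exact hεπ
    exact lt_of_mul_lt_mul_right this Real.pi_pos.le
  have h1' : (0 : ℤ) < n - m := by exact_mod_cast h1
  have h2' : n - m < (1 : ℤ) := by exact_mod_cast h2
  omega

/-- Any two arrows of `D₀` into `Spec ℝ` coincide. [cite: MochizukiFrdII2008, Def 3.1 (i) p.23] -/
theorem D0.hom_to_real_eq {K L : D0} (hL : L = D0.real) (f g : K ⟶ L) : f = g := by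
  subst hL
  exact Subsingleton.elim f g

/-- Arcs around `w` grow with their half-width. [cite: MochizukiFrdII2008, Def 3.1 (iii) p.24] -/
theorem arcDir_subset_arcDir (w : ↥(normOneSubgroup ℂ)) {ε ε' : ℝ} (h : ε ≤ ε') :
    arcDir w ε ⊆ arcDir w ε' := fun _ hz => ⟨by linarith [hz.1], by linarith [hz.2]⟩

/-! ### Arcs around `1`: products and powers -/

/-- Membership in an arc around `1` in terms of the argument. [cite: MochizukiFrdII2008, Def 3.1 (iii) p.24] -/
theorem mem_arcDir_one_iff_arg {ε : ℝ} (z : ↥(normOneSubgroup ℂ)) :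
    z ∈ arcDir 1 ε ↔ Complex.arg (((z : ℂˣ) : ℂ)) ∈ Set.Ioo (-ε) ε := by
  change relArg 1 z ∈ Set.Ioo (-ε) ε ↔ _
  unfold relArg
  rw [inv_one, mul_one]

/-- Products of points of arcs around `1` of half-widths `a`, `b` with `a + b ≤ π` lie in the arc of
half-width `a + b` (additivity of `arg`). [cite: MochizukiFrdII2008, Def 3.1 (iii) p.24] -/
theorem mul_mem_arcDir_one {a b : ℝ} {z y : ↥(normOneSubgroup ℂ)} (hz : z ∈ arcDir 1 a)
    (hy : y ∈ arcDir 1 b) (hab : a + b ≤ Real.pi) : z * y ∈ arcDir 1 (a + b) := by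
  rw [mem_arcDir_one_iff_arg] at hz hy ⊢
  rw [Subgroup.coe_mul, Units.val_mul,
    (Complex.arg_mul_eq_add_arg_iff (z : ℂˣ).ne_zero (y : ℂˣ).ne_zero).mpr
      ⟨by linarith [hz.1, hy.1], by linarith [hz.2, hy.2]⟩]
  exact ⟨by linarith [hz.1, hy.1], by linarith [hz.2, hy.2]⟩

/-- Powers of a small arc around `1`: `(arcDir 1 ε)^{n+1} ⊆ arcDir 1 ((n+1) ε)` as long as
`(n+1) ε ≤ π`. [cite: MochizukiFrdII2008, Def 3.1 (iii) p.24] -/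
theorem arcDir_one_pow_subset {ε : ℝ} (hε : 0 ≤ ε) :
    ∀ n : ℕ, ((n : ℝ) + 1) * ε ≤ Real.pi → arcDir 1 ε ^ (n + 1) ⊆ arcDir 1 (((n : ℝ) + 1) * ε) := by
  intro n
  induction n with
  | zero =>
    intro _
    show arcDir 1 ε ^ 1 ⊆ arcDir 1 ((((0 : ℕ) : ℝ) + 1) * ε)
    rw [pow_one, Nat.cast_zero, zero_add, one_mul]
  | succ n ih =>
    intro h
    have h' : ((n : ℝ) + 1) * ε ≤ Real.pi := by
      push_cast at h
      nlinarith
    rw [pow_succ]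
    intro x hx
    obtain ⟨y, hy, z, hz, rfl⟩ := Set.mem_mul.mp hx
    have hyz := mul_mem_arcDir_one (ih h' hy) hz (by push_cast at h; linarith)
    have e : ((n : ℝ) + 1) * ε + ε = (((n + 1 : ℕ) : ℝ) + 1) * ε := by push_cast; ring
    rwa [e] at hyz

/-- A rotated arc: `p · arcDir 1 ε ⊆ arcDir p ε`. [cite: MochizukiFrdII2008, Def 3.1 (iii) p.24] -/
theorem smul_arcDir_one_subset (p : ↥(normOneSubgroup ℂ)) (ε : ℝ) : p • arcDir 1 ε ⊆ arcDir p ε := by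
  rintro _ ⟨y, hy, rfl⟩
  have : p * y ∈ arcDir (p * 1) ε := (mem_arcDir_mul_iff p 1 y ε).mpr hy
  rwa [mul_one] at this

/-- In `S¹`, a nonempty open set contains `z` with `Im(v z^d) ≠ 0` (`d ≥ 1`), for any rotation `v`.
[cite: MochizukiFrdII2008, Lem 3.2 p.25] -/
theorem exists_mem_im_pow_ne_zero {U : Set ↥(normOneSubgroup ℂ)} (hU : IsOpen U) (hne : U.Nonempty)
    (v : ↥(normOneSubgroup ℂ)) {d : ℕ} (hd : 0 < d) :
    ∃ z ∈ U, (((v * z ^ d : ↥(normOneSubgroup ℂ)) : ℂˣ) : ℂ).im ≠ 0 := by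
  obtain ⟨z₀, hz₀⟩ := hne
  obtain ⟨ε, hε, hεπ, harc⟩ := exists_arcDir_subset hU hz₀
  have hmem : ∀ t ∈ Set.Ioo (-ε) ε, z₀ * expUnit t ∈ U := fun t ht => by
    apply harc
    rw [arcDir_eq_image z₀ hεπ]
    exact ⟨t, ht, rfl⟩
  have hdpos : (0 : ℝ) < d := by exact_mod_cast hd
  set w : ℂ := (((v * z₀ ^ d : ↥(normOneSubgroup ℂ)) : ℂˣ) : ℂ) with hw
  have hw1 : ‖w‖ = 1 := (mem_normOneSubgroup_iff ℂ _).1 (v * z₀ ^ d).2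
  have hwexp : w = Complex.exp (Complex.arg w * Complex.I) := by
    have := Complex.norm_mul_exp_arg_mul_I w
    rw [hw1, Complex.ofReal_one, one_mul] at this
    exact this.symm
  have him : ∀ t : ℝ, (((v * (z₀ * expUnit t) ^ d : ↥(normOneSubgroup ℂ)) : ℂˣ) : ℂ).im =
      Real.sin (Complex.arg w + d * t) := by
    intro t
    have : (((v * (z₀ * expUnit t) ^ d : ↥(normOneSubgroup ℂ)) : ℂˣ) : ℂ) =
        Complex.exp (Complex.arg w * Complex.I) * Complex.exp (((d : ℝ) * t : ℝ) * Complex.I) := by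
      rw [← hwexp, hw, mul_pow, ← mul_assoc, Subgroup.coe_mul, Units.val_mul, SubgroupClass.coe_pow,
        Units.val_pow_eq_pow_val, coe_expUnit, ← Complex.exp_nat_mul]
      push_cast
      ring_nf
    rw [this, ← Complex.exp_add, ← Complex.exp_ofReal_mul_I_im, Complex.ofReal_add, add_mul]
  have ht : ε / (2 * d) ∈ Set.Ioo (-ε) ε := by
    constructor
    · have : 0 < ε / (2 * d) := by positivity
      linarith
    · rw [div_lt_iff₀ (by positivity)]
      have hd1 : (1 : ℝ) ≤ d := by exact_mod_cast hd
      exact lt_mul_of_one_lt_right hε (by linarith)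
  have ht' : -(ε / (2 * d)) ∈ Set.Ioo (-ε) ε := ⟨by linarith [ht.2], by linarith [ht.1]⟩
  by_cases hp : (((v * (z₀ * expUnit (ε / (2 * d))) ^ d : ↥(normOneSubgroup ℂ)) : ℂˣ) : ℂ).im ≠ 0
  · exact ⟨_, hmem _ ht, hp⟩
  by_cases hm' : (((v * (z₀ * expUnit (-(ε / (2 * d)))) ^ d : ↥(normOneSubgroup ℂ)) : ℂˣ) : ℂ).im ≠ 0
  · exact ⟨_, hmem _ ht', hm'⟩
  exfalso
  rw [not_ne_iff, him, Real.sin_eq_zero_iff] at hp hm'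
  obtain ⟨n, hn⟩ := hp
  obtain ⟨m, hm⟩ := hm'
  have e1 : (d : ℝ) * (ε / (2 * d)) = ε / 2 := by field_simp
  have e2 : (d : ℝ) * (-(ε / (2 * d))) = -(ε / 2) := by rw [mul_neg, e1]
  rw [e1] at hn
  rw [e2] at hm
  have hk : ((n - m : ℤ) : ℝ) * Real.pi = ε := by
    rw [Int.cast_sub, sub_mul, hn, hm]
    ring
  have h1 : (0 : ℝ) < (n - m : ℤ) := by
    have : (0 : ℝ) < ((n - m : ℤ) : ℝ) * Real.pi := by rw [hk]; exact hε
    exact pos_of_mul_pos_left this Real.pi_pos.le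
  have h2 : ((n - m : ℤ) : ℝ) < 1 := by
    have : ((n - m : ℤ) : ℝ) * Real.pi < 1 * Real.pi := by rw [hk, one_mul]; exact hεπ
    exact lt_of_mul_lt_mul_right this Real.pi_pos.le
  have h1' : (0 : ℤ) < n - m := by exact_mod_cast h1
  have h2' : n - m < (1 : ℤ) := by exact_mod_cast h2
  omega

namespace C0

/-- If the angular part of `X` is the right half-circle, every point of every base change
`A_X|` has positive real part (twists preserve real parts). [cite: MochizukiFrdII2008, Def 3.1 (iv) p.24] -/
theorem re_pos_of_mem_pullRegion {X : C0} (hX : X.region.dir = arcDir 1 (Real.pi / 2)) {L : D0}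
    (f : L ⟶ X.base) {y : ℂˣ} (hy : y ∈ pullRegion X f) : 0 < (y : ℂ).re := by
  unfold pullRegion at hy
  obtain ⟨x, hx, rfl⟩ := hy
  have h1 : unitPart ℂ x ∈ arcDir 1 (Real.pi / 2) := by
    rw [← hX]
    exact hx.1
  rw [mem_arcDir_one_iff, re_unitPart_pos_iff] at h1
  show 0 < ((D0.galAct (D0.Hom.twists f) x : ℂˣ) : ℂ).re
  rw [re_galAct]
  exact h1

end C0

end ArchFrd

end

end Literature.AlgebraicGeometry.Frobenioids
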